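import Literature.Analysis.FluidPDE.FluidComputer.ThresholdDrainWindow
import Literature.Analysis.FluidPDE.FluidComputer.TubeStep
import HarnessLib

/-!
# The quiet branch of the threshold gate: no input pulse ⇒ no output (bp3 gen 13)

HONEST FRAMING: low prior, high value-of-information experiment on Tao's machine paradigm; NOT a
claim that NS blows up.  Elementary: for the 5-mode truncated circuit `thresholdCircuit`
(`ThresholdGate.lean`) with an abstract forcing defect `δ`, nothing is asserted about any fluid
equation.

The complementary (AVOID) branch of the gate in the same typed form as the REACH branch
`TubeTable.inputBox_reach_outputLoaded` (`TubeCertificate.lean`): a forced window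
(`IsForcedWindow`) whose initial energy plus the drift budget `10δR_b·τ` is below `R_b²` never leaves
the open cube `|xᵢ| < R_b`, its energy drifts by at most `10δR_b·t` (`IsForcedWindow.quiet`), and in
particular the output mode carries at most `E(0) + 10δR_b·t` (`IsForcedWindow.quiet_output`).  The
proof is a continuous induction (`persist_of_open_closed`, `TubeStep.lean`) on the cube bound: closed
by the energy estimate `IsForcedWindow.energy_abs_sub_le`, open by continuity.  The design-point
instance with numbers is `TubeTable.noInput_quiet` (`TubeCertificate.lean`).
-/

open Set Filter Topology

namespace Literature.Analysis.FluidPDE.FluidComputer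

open Tao2016AveragedNS (energy)

/-- **The quiet branch** (no input pulse ⇒ no output): a forced window of the threshold circuit whose
initial energy plus the drift budget `10δR_b·τ` is below `R_b²` stays in the open cube `|xᵢ| < R_b`
and its energy drifts by at most `10δR_b·t` (continuous induction `persist_of_open_closed` on the cube
bound, closed by the energy estimate `energy_abs_sub_le`, open by continuity). [folklore] -/
theorem IsForcedWindow.quiet {ε σ ν μ r κ δ τ : ℝ} {x : ℝ → Fin 5 → ℝ}
    (h : IsForcedWindow ε σ ν μ r κ δ τ x) (hτ : 0 ≤ τ) (hδ : 0 ≤ δ) {Rb : ℝ} (hRb : 0 < Rb)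
    (hE : energy (x 0) + 10 * (δ * Rb) * τ < Rb ^ 2) :
    ∀ t ∈ Icc 0 τ, |energy (x t) - energy (x 0)| ≤ 10 * (δ * Rb) * t ∧ ∀ i, |x t i| < Rb := by
  have hdrift0 : 0 ≤ 10 * (δ * Rb) * τ := by positivity
  -- the energy estimate on `[0, t]` from the cube bound on `[0, t)`
  have key : ∀ t ∈ Icc 0 τ, (∀ s ∈ Ico 0 t, ∀ i, |x s i| < Rb) →
      |energy (x t) - energy (x 0)| ≤ 10 * (δ * Rb) * t := by
    intro t ht hP
    exact (h.mono ht.2).energy_abs_sub_le hRb.le (fun s hs i => (hP s hs i).le) t ⟨ht.1, le_rfl⟩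
  have cube_of : ∀ t ∈ Icc 0 τ, |energy (x t) - energy (x 0)| ≤ 10 * (δ * Rb) * t →
      ∀ i, |x t i| < Rb := by
    intro t ht hd i
    have h1 := (abs_le.1 hd).2
    have h2 : 10 * (δ * Rb) * t ≤ 10 * (δ * Rb) * τ := mul_le_mul_of_nonneg_left ht.2 (by positivity)
    have h3 : x t i ^ 2 < Rb ^ 2 := lt_of_le_of_lt (sq_apply_le_energy (x t) i) (by linarith)
    exact abs_lt_of_sq_lt_sq h3 hRb.le
  have hP : ∀ t ∈ Icc 0 τ, ∀ i, |x t i| < Rb := by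
    refine persist_of_open_closed (P := fun t => ∀ i, |x t i| < Rb) hτ ?_ ?_ ?_
    · exact cube_of 0 ⟨le_rfl, hτ⟩ (by simp)
    · intro t ht hprev
      exact cube_of t ⟨ht.1.le, ht.2⟩ (key t ⟨ht.1.le, ht.2⟩ hprev)
    · intro s hs hprev
      have hcs : ContinuousWithinAt x (Icc 0 τ) s := h.continuousOn s ⟨hs.1, hs.2.le⟩
      rw [eventually_all]
      intro i
      have hci : Tendsto (fun t => |x t i|) (𝓝[Icc 0 τ] s) (𝓝 |x s i|) :=
        ((continuous_abs.comp (continuous_apply i)).tendsto (x s)).comp hcs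
      exact hci.eventually_lt_const (hprev s ⟨hs.1, le_rfl⟩ i)
  intro t ht
  exact ⟨key t ht fun s hs => hP s ⟨hs.1, hs.2.le.trans ht.2⟩, hP t ht⟩

/-- The quiet branch, output form: `ã(t)² ≤ E(0) + 10δR_b·t`. [folklore] -/
theorem IsForcedWindow.quiet_output {ε σ ν μ r κ δ τ : ℝ} {x : ℝ → Fin 5 → ℝ}
    (h : IsForcedWindow ε σ ν μ r κ δ τ x) (hτ : 0 ≤ τ) (hδ : 0 ≤ δ) {Rb : ℝ} (hRb : 0 < Rb)
    (hE : energy (x 0) + 10 * (δ * Rb) * τ < Rb ^ 2) :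
    ∀ t ∈ Icc 0 τ, x t 4 ^ 2 ≤ energy (x 0) + 10 * (δ * Rb) * t := by
  intro t ht
  have h1 := (abs_le.1 ((h.quiet hτ hδ hRb hE) t ht).1).2
  linarith [sq_apply_le_energy (x t) 4]

end Literature.Analysis.FluidPDE.FluidComputer
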